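import Summits.ResolutionOfSingularities.ResolutionOfSingularities.Theorems.PurelyInseparableDim4ChartAtlasSNCDisjoint
import HarnessLib

/-!
# Purely inseparable four-folds `z^p + F(x₁, …, x₄)`: the GOOD case of the S3-N2 dichotomy at chart level, in membership form
# (brick S3-N2, positive side; cell `res-dim4-pi`, typ-2 g5)

[OURS · counted 0] (D-0157 DOOR 2; DR-157-C; desk WORD #115 (a)/(c), WORD #131 (c)). The positive chart theorems of the S3-N2
dichotomy (p691155, p692862) are stated for boundary lists `l.map (i ↦ (xᵢ + βᵢ·x_j + cᵢ)·𝒪)` with `β = c = 0` on the centre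
variables. The W-level assembly (old boundary ↦ strict transforms ↦ chart readings, p696282) produces lists that ALSO contain the
empty member `⊤` (the old `{x_l = 0}` on the chart `x_l`) and FAR members `(xᵢ + c)·𝒪`, `i ∈ Λ_T`, `c ≠ 0` (disjoint from the
centre), in an order fixed by the old boundary. PROVED here (no `sorry`, no new axiom):

* `hasSNCWith_of_forall_mem` (generic) — `HasSNCWith E C` depends on `E` only through MEMBERSHIP: it descends to every list
  whose members are members of `E` (crit-3 rider R-a, K-A3-31);
* `hasSNCWith_append_of_forall_disjoint` (generic) — members disjoint from the centre may be prepended (iterating p694533);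
* `disjoint_support_translate_CΛ'` — `(xᵢ + c)·𝒪`, `i ∈ Λ`, `c ≠ 0`, misses `C_Λ` (any index `i : Fin 5`);
* **`hasSNCWith_offShear_translatedHyperplanes_𝓘Λ_far`** — p692862's `hasSNCWith_offShear_translatedHyperplanes_𝓘Λ` WITHOUT the
  hypothesis `c = 0 on Λ_T` (only `c 0 = 0`): far members are harmless;
* **`hasSNCWith_𝓘Λ_of_forall_mem_shape`** — THE GOOD-CHART THEOREM in membership form: any list `E` each of whose members is `⊤` or
  `(xᵢ + βᵢ·x_j + cᵢ)·𝒪` for some `i` (`β_j = 0`, `β = 0` on `Λ_T`, `c 0 = 0`) has snc with `𝓘Λ_T` — i.e. a chart WITHOUT an in-centre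
  sheared member (bad set `B ⊆ {x_j·𝒪}`, `|B| ≤ 1`) is good, whatever the far members and the order.

Nothing here is a statement about resolution of singularities in dimension ≥ 4 / characteristic `p` (NOT proved anywhere in this
programme). bears_on: LADDER-RESOLUTION:D157-DOOR2 (res-dim4-pi). Supports stmt-ResolutionOfSingularities-16155 (helper).
-/

-- every declaration of this summit lives under `Summit.ResolutionOfSingularities.ResolutionOfSingularities`
-- (summit = problem), which the duplicate-namespace linter flags; house convention (cf. the Target file).
set_option linter.dupNamespace false

noncomputable section

open MvPolynomial Finset CategoryTheory AlgebraicGeometry Opposite TopologicalSpace IsLocalRing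
open AlgebraicGeometry.Scheme.IdealSheafData (ofIdealTop vanishingIdeal)

namespace Summit.ResolutionOfSingularities.ResolutionOfSingularities.Theorems.PIDim4

open Literature.AlgebraicGeometry.Resolution
open Literature.AlgebraicGeometry.Resolution.AffinePointBlowup (P A γ coord Wtop ξ)

namespace ChartDictionary

/-! ## §1 Generic: membership invariance and prepending disjoint members -/

section Generic

universe u

variable {X : Scheme.{u}} {E E' B : List X.IdealSheafData} {C : X.IdealSheafData}

/-- **`HasSNCWith E C` depends on `E` only through membership**: if every member of `E'` is a member of `E` then
`HasSNCWith E C → HasSNCWith E' C` (order, repetitions and omissions are immaterial). -/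
theorem hasSNCWith_of_forall_mem (hE : HasSNCWith E C) (h : ∀ D ∈ E', D ∈ E) : HasSNCWith E' C := by
  intro x
  obtain ⟨hreg, u, hu, ⟨ι, hinj, hι⟩, hC⟩ := hE x
  refine ⟨hreg, u, hu, ⟨fun D => ι ⟨D.1, h D.1 D.2.1, D.2.2⟩, fun D₁ D₂ heq => ?_,
    fun D => hι ⟨D.1, h D.1 D.2.1, D.2.2⟩⟩, hC⟩
  exact Subtype.ext (congrArg (fun D : {D // D ∈ E ∧ x ∈ D.support} => D.1) (hinj heq))

/-- **Prepending members disjoint from the centre**: if `E` has snc with `C`, every member of `B` misses `V(C)` and the whole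
list `B ++ E` is snc, then `B ++ E` has snc with `C`. -/
theorem hasSNCWith_append_of_forall_disjoint [IsLocallyNoetherian X] (h : HasSNCWith E C)
    (hB : ∀ D ∈ B, Disjoint (D.support : Set X) (C.support : Set X)) (hsnc : HasSNC (B ++ E)) :
    HasSNCWith (B ++ E) C := by
  induction B with
  | nil => exact h
  | cons D B ih =>
    rw [List.cons_append]
    refine hasSNCWith_cons_of_disjoint_support (ih (fun D' hD' => hB D' (List.mem_cons_of_mem _ hD')) ?_)
      (hB D List.mem_cons_self) hsnc
    exact HasSNCWith.sublist ((List.sublist_cons_self D (B ++ E))) hsnc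

end Generic

/-! ## §2 Far members are harmless -/

variable {K : Type} [Field K] {T : Finset (Fin 4)} {j : Fin 4} {β c : Fin (4 + 1) → K}

/-- The translated hyperplane `(xᵢ + b)·𝒪`, `b ≠ 0`, MISSES every coordinate subspace `C_Λ` with `i ∈ Λ` (any index `i`). -/
theorem disjoint_support_translate_CΛ' {Λ : Set (Fin (4 + 1))} {i : Fin (4 + 1)} (hi : i ∈ Λ) {b : K} (hb : b ≠ 0) :
    Disjoint ((ofIdealTop (Ideal.span {(γ 4 K).symm (X i + C b)})).support : Set (P 4 K))
      (AffineCoordBlowup.CΛ 4 K Λ : Set (P 4 K)) := by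
  rw [Set.disjoint_left]
  intro y hy hyC
  rw [SetLike.mem_coe, ofIdealTop_span_γ_symm_eq_shf, Literature.AlgebraicGeometry.Hironaka2017.SpecOrders.mem_support_shf_iff,
    Ideal.span_singleton_le_iff_mem] at hy
  have hXi : (X i : A 4 K) ∈ y.asIdeal := (AffineCoordBlowup.mem_CΛ_iff' 4 K Λ y).mp hyC _ hi
  have hb' : (C b : A 4 K) ∈ y.asIdeal := by
    have h := y.asIdeal.sub_mem hy hXi
    rwa [add_sub_cancel_left] at h
  exact y.2.ne_top ((Ideal.eq_top_iff_one _).mpr (by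
    have h := y.asIdeal.mul_mem_left (C b⁻¹) hb'
    rwa [← C_mul, inv_mul_cancel₀ hb, C_1] at h))

/-- Far members in front: for a list `lb` of FAR indices (`i ∈ Λ_T`, `cᵢ ≠ 0`) and a list `l₀` without far indices,
`HasSNCWith ((lb ++ l₀).map shape) 𝓘Λ_T`. -/
theorem hasSNCWith_offShear_translatedHyperplanes_𝓘Λ_far_append (hβj : β j.succ = 0)
    (hβT : ∀ i ∈ insert (0 : Fin (4 + 1)) (Fin.succ '' (T : Set (Fin 4))), β i = 0) (hc0 : c 0 = 0)
    (lb l₀ : List (Fin (4 + 1)))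
    (hlb : ∀ i ∈ lb, i ∈ insert (0 : Fin (4 + 1)) (Fin.succ '' (T : Set (Fin 4))) ∧ c i ≠ 0)
    (hl₀ : ∀ i ∈ l₀, i ∈ insert (0 : Fin (4 + 1)) (Fin.succ '' (T : Set (Fin 4))) → c i = 0) :
    HasSNCWith ((lb ++ l₀).map fun i => ofIdealTop (Ideal.span {(γ 4 K).symm (X i + C (β i) * X j.succ + C (c i))}))
      (AffineCoordBlowup.𝓘Λ 4 K (insert 0 (Fin.succ '' (T : Set (Fin 4))))) := by
  classical
  set Λ : Set (Fin (4 + 1)) := insert 0 (Fin.succ '' (T : Set (Fin 4))) with hΛ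
  -- the whole configuration is snc (auxiliary centre `V(z)`, `T = ∅`)
  have hβ0 : ∀ i ∈ insert (0 : Fin (4 + 1)) (Fin.succ '' ((∅ : Finset (Fin 4)) : Set (Fin 4))), β i = 0 := by
    intro i hi
    rw [Finset.coe_empty, Set.image_empty] at hi
    rcases hi with hi | hi
    · exact hβT i (hi ▸ Set.mem_insert _ _)
    · exact absurd hi (Set.notMem_empty _)
  have hc0' : ∀ i ∈ insert (0 : Fin (4 + 1)) (Fin.succ '' ((∅ : Finset (Fin 4)) : Set (Fin 4))), c i = 0 := by
    intro i hi
    rw [Finset.coe_empty, Set.image_empty] at hi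
    rcases hi with hi | hi
    · rw [hi]; exact hc0
    · exact absurd hi (Set.notMem_empty _)
  have hall : ∀ l : List (Fin (4 + 1)),
      HasSNC (l.map fun i => ofIdealTop (Ideal.span {(γ 4 K).symm (X i + C (β i) * X j.succ + C (c i))})) := fun l =>
    (hasSNCWith_offShear_translatedHyperplanes_𝓘Λ (K := K) (T := ∅) (j := j) (c := c) hβj hβ0 hc0' l).hasSNC
  -- base: no far member — zero the constants on `Λ_T` without changing the members
  set c₀ : Fin (4 + 1) → K := fun i => if i ∈ Λ then 0 else c i with hc₀
  have hc₀T : ∀ i ∈ Λ, c₀ i = 0 := fun i hi => by rw [hc₀]; exact if_pos hi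
  have hbase : HasSNCWith (l₀.map fun i => ofIdealTop (Ideal.span {(γ 4 K).symm (X i + C (β i) * X j.succ + C (c i))}))
      (AffineCoordBlowup.𝓘Λ 4 K Λ) := by
    have h := hasSNCWith_offShear_translatedHyperplanes_𝓘Λ (K := K) (T := T) (j := j) (c := c₀) hβj hβT hc₀T l₀
    rw [← hΛ] at h
    have hl : (l₀.map fun i => ofIdealTop (Ideal.span {(γ 4 K).symm (X i + C (β i) * X j.succ + C (c i))})) =
        l₀.map fun i => ofIdealTop (Ideal.span {(γ 4 K).symm (X i + C (β i) * X j.succ + C (c₀ i))}) := by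
      refine List.map_congr_left fun i hi => ?_
      have hci : c i = c₀ i := by
        by_cases hiΛ : i ∈ Λ
        · rw [hl₀ i hi hiΛ, hc₀T i hiΛ]
        · rw [hc₀]
          dsimp only
          rw [if_neg hiΛ]
      rw [hci]
    rw [hl]
    exact h
  -- step: prepend the far members one by one
  rw [List.map_append]
  refine hasSNCWith_append_of_forall_disjoint hbase (fun D hD => ?_) (by rw [← List.map_append]; exact hall _)
  obtain ⟨i, hi, rfl⟩ := List.mem_map.mp hD
  obtain ⟨hiΛ, hci⟩ := hlb i hi
  rw [hβT i hiΛ, C_0, zero_mul, add_zero, AffineCoordBlowup.support_𝓘Λ]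
  exact disjoint_support_translate_CΛ' hiΛ hci

/-- **FAR MEMBERS ARE HARMLESS** — p692862's `hasSNCWith_offShear_translatedHyperplanes_𝓘Λ` without the hypothesis `c = 0` on
`Λ_T` (only `c 0 = 0`, the `z`-slot): members `(xᵢ + cᵢ)·𝒪` with `i ∈ Λ_T`, `cᵢ ≠ 0` miss the centre. -/
theorem hasSNCWith_offShear_translatedHyperplanes_𝓘Λ_far (hβj : β j.succ = 0)
    (hβT : ∀ i ∈ insert (0 : Fin (4 + 1)) (Fin.succ '' (T : Set (Fin 4))), β i = 0) (hc0 : c 0 = 0) (l : List (Fin (4 + 1))) :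
    HasSNCWith (l.map fun i => ofIdealTop (Ideal.span {(γ 4 K).symm (X i + C (β i) * X j.succ + C (c i))}))
      (AffineCoordBlowup.𝓘Λ 4 K (insert 0 (Fin.succ '' (T : Set (Fin 4))))) := by
  classical
  set Λ : Set (Fin (4 + 1)) := insert 0 (Fin.succ '' (T : Set (Fin 4))) with hΛ
  let far : Fin (4 + 1) → Prop := fun i => i ∈ Λ ∧ c i ≠ 0
  have h := hasSNCWith_offShear_translatedHyperplanes_𝓘Λ_far_append (K := K) (T := T) hβj hβT hc0
    (l.filter fun i => far i) (l.filter fun i => ¬ far i)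
    (fun i hi => by
      have h2 := (List.mem_filter.mp hi).2
      simp only [decide_eq_true_eq] at h2
      exact h2)
    (fun i hi hiΛ => by
      have h2 := (List.mem_filter.mp hi).2
      simp only [decide_eq_true_eq] at h2
      by_contra hci
      exact h2 ⟨hiΛ, hci⟩)
  refine hasSNCWith_of_forall_mem h fun D hD => ?_
  obtain ⟨i, hi, rfl⟩ := List.mem_map.mp hD
  refine List.mem_map.mpr ⟨i, ?_, rfl⟩
  by_cases hfi : far i
  · exact List.mem_append.mpr (Or.inl (List.mem_filter.mpr ⟨hi, by simp only [decide_eq_true_eq]; exact hfi⟩))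
  · exact List.mem_append.mpr (Or.inr (List.mem_filter.mpr ⟨hi, by simp only [decide_eq_true_eq]; exact hfi⟩))

/-! ## §3 The good-chart theorem in membership form -/

/-- **THE GOOD CHART (S3-N2, positive side, membership form).** `β_j = 0`, `β = 0` on `Λ_T`, `c 0 = 0`; `E` any list of ideal
sheaves on `𝔸⁵` each of whose members is `⊤` or `(xᵢ + βᵢ·x_j + cᵢ)·𝒪` for some index `i`. Then `HasSNCWith E 𝓘Λ_T`. (No
in-centre sheared member: the bad set is `⊆ {x_j·𝒪}`.) -/
theorem hasSNCWith_𝓘Λ_of_forall_mem_shape (hβj : β j.succ = 0)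
    (hβT : ∀ i ∈ insert (0 : Fin (4 + 1)) (Fin.succ '' (T : Set (Fin 4))), β i = 0) (hc0 : c 0 = 0)
    {E : List (Scheme.IdealSheafData (P 4 K))}
    (hE : ∀ D ∈ E, D = ⊤ ∨ ∃ i : Fin (4 + 1), D = ofIdealTop (Ideal.span {(γ 4 K).symm (X i + C (β i) * X j.succ + C (c i))})) :
    HasSNCWith E (AffineCoordBlowup.𝓘Λ 4 K (insert 0 (Fin.succ '' (T : Set (Fin 4))))) := by
  have h := hasSNCWith_cons_top
    (hasSNCWith_offShear_translatedHyperplanes_𝓘Λ_far (K := K) (T := T) hβj hβT hc0 (List.finRange (4 + 1)))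
  refine hasSNCWith_of_forall_mem h fun D hD => ?_
  rcases hE D hD with rfl | ⟨i, rfl⟩
  · exact List.mem_cons_self
  · exact List.mem_cons_of_mem _ (List.mem_map.mpr ⟨i, List.mem_finRange i, rfl⟩)

end ChartDictionary

end Summit.ResolutionOfSingularities.ResolutionOfSingularities.Theorems.PIDim4

end
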